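import Mathlib.Topology.ContinuousMap.Bounded.ArzelaAscoli
import Mathlib.Topology.MetricSpace.HausdorffDistance
import Mathlib.Topology.MetricSpace.Isometry
import Mathlib.Topology.MetricSpace.Equicontinuity
import HarnessLib

/-!
# The isometry group of a compact metric space is compact

Two classical facts of metric geometry that Mathlib lacks and that equivariant Gromov–Hausdorff
theory uses silently (Fukaya–Yamaguchi 1992, §3; Huang–Huang–Wang–Zhu 2026, §4 p. 13: "`N₀` … a
subgroup of `Isom(Ŷ)`, which is compact", "`G/G₀` is a compact group", and §6.1 p. 20: "passing to a
subsequence, `Hᵢ` converges to a subgroup `H` of `G` and `gᵢ^{lᵢ}` converges to a nontrivial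
element `g ∈ H`"):

§1. An isometric self-map of a compact metric space is SURJECTIVE
(`Isometry.surjective_of_compactSpace`; if `x ∉ f(X)` then the orbit `fⁿ(x)` is
`d(x, f(X))`-separated, contradicting sequential compactness), hence an isometric equivalence
(`Isometry.isometryEquivOfCompactSpace`).

§2. Inside the metric space `X →ᵇ X` of bounded continuous self-maps with the uniform distance, the
set `isometrySet X` of isometric self-maps is closed and, by Arzelà–Ascoli
(`BoundedContinuousFunction.arzela_ascoli₁`; isometries are equicontinuous), COMPACT
(`isCompact_isometrySet`); it is exactly the image of `Isom(X) = X ≃ᵢ X` (`range_toBCF`).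

§3. Consequently every sequence of isometries `gₙ : X ≃ᵢ X` of a compact metric space has a
subsequence converging UNIFORMLY to an isometry `g : X ≃ᵢ X` (`exists_tendstoUniformly_subseq`),
and uniform limits of isometries are isometries (`exists_isometryEquiv_of_tendstoUniformly`).

Everything here is a definition with body or a proved theorem; no named facts.

## References

* H. Freudenthal, W. Hurewicz, *Dehnungen, Verkürzungen, Isometrien*, Fund. Math. 26 (1936)
  120–122 (§1). Cited textually; folklore.
* K. Fukaya, T. Yamaguchi, *The fundamental groups of almost nonnegatively curved manifolds*,
  Ann. of Math. 136 (1992) 253–333, §3.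
* H. Huang, X.-T. Huang, J. Wang, X. Zhu, arXiv:2605.24380 (2026), §4 p. 13, §6.1 p. 20.
  [HuangHuangWangZhu2026]
-/

noncomputable section

open Metric Set Filter BoundedContinuousFunction

open scoped Topology

namespace Literature.Geometry.MetricGeometry

/-! ### §1. Isometric self-maps of compact metric spaces are surjective -/

section Surjective

/-- Iterates of an isometry (of a pseudo-emetric space) are isometries. (The tree's
`Literature.LinearAlgebra.isometry_iterate` is the normed-group case.) [folklore] -/
theorem isometry_iterate {X : Type*} [PseudoEMetricSpace X] {f : X → X} (hf : Isometry f)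
    (n : ℕ) : Isometry f^[n] := by
  induction n with
  | zero => exact isometry_id
  | succ n ih =>
    rw [Function.iterate_succ']
    exact hf.comp ih

variable {X : Type*} [MetricSpace X] [CompactSpace X]

/-- An isometric self-map of a compact metric space is surjective (Freudenthal–Hurewicz 1936).
Proof: if `x ∉ f(X)` (a closed set) then `ε = d(x, f(X)) > 0` and for `m < n`,
`d(fᵐ x, fⁿ x) = d(x, fⁿ⁻ᵐ x) ≥ ε`, so the orbit of `x` has no Cauchy subsequence, contradicting
compactness. [folklore] -/
theorem _root_.Isometry.surjective_of_compactSpace {f : X → X} (hf : Isometry f) :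
    Function.Surjective f := by
  intro x
  by_contra hx
  have hxr : x ∉ range f := fun ⟨a, ha⟩ ↦ hx ⟨a, ha⟩
  have hclosed : IsClosed (range f) := (isCompact_range hf.continuous).isClosed
  have hne : (range f).Nonempty := ⟨f x, mem_range_self x⟩
  have hε : 0 < infDist x (range f) := (hclosed.notMem_iff_infDist_pos hne).mp hxr
  have hsep : ∀ m n : ℕ, m < n → infDist x (range f) ≤ dist (f^[m] x) (f^[n] x) := by
    intro m n hmn
    obtain ⟨k, rfl⟩ := Nat.exists_eq_add_of_lt hmn
    rw [show m + k + 1 = m + (k + 1) by ring, Function.iterate_add_apply,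
      (isometry_iterate hf m).dist_eq]
    exact infDist_le_dist_of_mem ⟨f^[k] x, (Function.iterate_succ_apply' f k x).symm⟩
  obtain ⟨a, -, φ, hφ, hlim⟩ :=
    (isCompact_univ (X := X)).tendsto_subseq (x := fun n ↦ f^[n] x) fun _ ↦ mem_univ _
  have hc := hlim.cauchySeq
  rw [Metric.cauchySeq_iff'] at hc
  obtain ⟨N, hN⟩ := hc (infDist x (range f)) hε
  have h1 := hN (N + 1) N.le_succ
  have h2 := hsep (φ N) (φ (N + 1)) (hφ N.lt_succ_self)
  simp only [Function.comp_apply] at h1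
  rw [dist_comm] at h1
  linarith

/-- An isometric self-map of a compact metric space, as an isometric equivalence. [folklore] -/
def _root_.Isometry.isometryEquivOfCompactSpace {f : X → X} (hf : Isometry f) : X ≃ᵢ X :=
  ⟨Equiv.ofBijective f ⟨hf.injective, hf.surjective_of_compactSpace⟩, hf⟩

/-- Unfolding lemma. [folklore] -/
theorem _root_.Isometry.isometryEquivOfCompactSpace_apply {f : X → X} (hf : Isometry f) (x : X) :
    hf.isometryEquivOfCompactSpace x = f x :=
  rfl

end Surjective

/-! ### §2. The isometries form a compact subset of `X →ᵇ X` -/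

section Compact

variable (X : Type*) [MetricSpace X]

/-- The set of isometric self-maps of a (compact) metric space, as a subset of the metric space
`X →ᵇ X` of bounded continuous self-maps (uniform distance). [folklore] -/
def isometrySet : Set (X →ᵇ X) :=
  {F | Isometry (F : X → X)}

variable {X}

/-- Membership in `isometrySet`. [folklore] -/
theorem mem_isometrySet_iff (F : X →ᵇ X) : F ∈ isometrySet X ↔ Isometry (F : X → X) :=
  Iff.rfl

variable (X) in
/-- The isometries form a closed subset of `X →ᵇ X` (even for pointwise convergence; no
compactness needed). [folklore] -/
theorem isClosed_isometrySet : IsClosed (isometrySet X) := by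
  have h : isometrySet X = ⋂ x : X, ⋂ y : X, {F : X →ᵇ X | dist (F x) (F y) = dist x y} := by
    ext F
    simp only [mem_isometrySet_iff, isometry_iff_dist_eq, mem_iInter, mem_setOf_eq]
  rw [h]
  exact isClosed_iInter fun x ↦ isClosed_iInter fun y ↦
    isClosed_eq ((continuous_eval_const x).dist (continuous_eval_const y)) continuous_const

variable [CompactSpace X]

variable (X) in
/-- THE ISOMETRY GROUP OF A COMPACT METRIC SPACE IS COMPACT (for the uniform distance): by
Arzelà–Ascoli, since isometries are equicontinuous and form a closed set.
[cite: HuangHuangWangZhu2026, §4 p. 13 ("Isom(Ŷ), which is compact")] -/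
theorem isCompact_isometrySet : IsCompact (isometrySet X) :=
  arzela_ascoli₁ _ (isClosed_isometrySet X)
    (Metric.equicontinuous_of_continuity_modulus id tendsto_id _
      fun x y F ↦ (F.2.dist_eq x y).le)

/-- An isometric equivalence as a bounded continuous self-map. [folklore] -/
def toBCF (g : X ≃ᵢ X) : X →ᵇ X :=
  mkOfCompact ⟨g, g.continuous⟩

/-- Unfolding lemma for `toBCF`. [folklore] -/
@[simp]
theorem toBCF_apply (g : X ≃ᵢ X) (x : X) : toBCF g x = g x :=
  rfl

/-- `toBCF` is injective. [folklore] -/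
theorem toBCF_injective : Function.Injective (toBCF : (X ≃ᵢ X) → X →ᵇ X) :=
  fun g g' h ↦ IsometryEquiv.ext fun x ↦ by rw [← toBCF_apply g, h, toBCF_apply]

/-- Pointwise distances are bounded by the uniform distance:
`d(g x, g' x) ≤ d(toBCF g, toBCF g')`. [folklore] -/
theorem dist_apply_le_dist_toBCF (g g' : X ≃ᵢ X) (x : X) :
    dist (g x) (g' x) ≤ dist (toBCF g) (toBCF g') :=
  dist_coe_le_dist (f := toBCF g) (g := toBCF g') x

/-- `d(toBCF g, toBCF g') ≤ C` iff `d(g x, g' x) ≤ C` for all `x` (`C ≥ 0`). [folklore] -/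
theorem dist_toBCF_le_iff {g g' : X ≃ᵢ X} {C : ℝ} (hC : 0 ≤ C) :
    dist (toBCF g) (toBCF g') ≤ C ↔ ∀ x : X, dist (g x) (g' x) ≤ C :=
  dist_le hC

/-- The image of `Isom(X)` in `X →ᵇ X` is exactly the set of isometric self-maps (surjectivity
being automatic on a compact space, §1). [folklore] -/
theorem range_toBCF : range (toBCF : (X ≃ᵢ X) → X →ᵇ X) = isometrySet X := by
  ext F
  constructor
  · rintro ⟨g, rfl⟩
    exact g.isometry
  · intro hF
    exact ⟨hF.isometryEquivOfCompactSpace, by ext x; rfl⟩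

end Compact

/-! ### §3. Sequential compactness: uniformly convergent subsequences of isometries -/

section Sequential

variable {X : Type*} [MetricSpace X] [CompactSpace X]

/-- A uniform (indeed pointwise) limit of isometric equivalences of a compact metric space is (the
coercion of) an isometric equivalence. [folklore] -/
theorem exists_isometryEquiv_of_tendstoUniformly {ι : Type*} {l : Filter ι} [l.NeBot]
    {g : ι → X ≃ᵢ X} {f : X → X} (h : TendstoUniformly (fun i ↦ ⇑(g i)) f l) :
    ∃ g₀ : X ≃ᵢ X, ⇑g₀ = f := by
  have hf : Isometry f := by
    refine Isometry.of_dist_eq fun x y ↦ ?_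
    have hx : Tendsto (fun i ↦ g i x) l (𝓝 (f x)) := h.tendsto_at x
    have hy : Tendsto (fun i ↦ g i y) l (𝓝 (f y)) := h.tendsto_at y
    have hd : Tendsto (fun i ↦ dist (g i x) (g i y)) l (𝓝 (dist (f x) (f y))) := hx.dist hy
    have hc : (fun i ↦ dist (g i x) (g i y)) = fun _ ↦ dist x y :=
      funext fun i ↦ (g i).dist_eq x y
    rw [hc] at hd
    exact tendsto_nhds_unique hd tendsto_const_nhds
  exact ⟨hf.isometryEquivOfCompactSpace, rfl⟩

/-- SEQUENTIAL COMPACTNESS OF THE ISOMETRY GROUP: every sequence of isometries of a compact metric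
space has a subsequence converging uniformly to an isometry ("passing to a subsequence,
`gᵢ → g ∈ Isom`"; Huang–Huang–Wang–Zhu 2026, §6.1 p. 20, and throughout equivariant
Gromov–Hausdorff theory). [cite: HuangHuangWangZhu2026, §4 p. 13 and §6.1 p. 20] -/
theorem exists_tendstoUniformly_subseq (g : ℕ → X ≃ᵢ X) :
    ∃ (g₀ : X ≃ᵢ X) (φ : ℕ → ℕ), StrictMono φ ∧
      TendstoUniformly (fun n ↦ ⇑(g (φ n))) g₀ atTop := by
  obtain ⟨F, hF, φ, hφ, hlim⟩ := (isCompact_isometrySet X).tendsto_subseq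
    (x := fun n ↦ toBCF (g n)) fun n ↦ (g n).isometry
  exact ⟨hF.isometryEquivOfCompactSpace, φ, hφ, tendsto_iff_tendstoUniformly.mp hlim⟩

end Sequential

end Literature.Geometry.MetricGeometry

end
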